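import Literature.AnabelianGeometry.EtaleTheta.Discharge.Sec5Lem59ivToyMuThreeData
import Literature.AnabelianGeometry.EtaleTheta.Discharge.Sec5BiThetaIso

/-!
# [EtTh] §5, Lemma 5.9 (iv): `EnvIsoBiTheta` / `FrdIsMonoThetaEnv` INHABITED — and decided — at a datum with NON-TRIVIAL cyclotome `μ_3(B_N)` (p. 332 / PDF p. 106)

Mochizuki, *The étale theta function and its Frobenioid-theoretic manifestations*, Publ. RIMS **45**
(2009) [cite: MochizukiEtTh2009, Lem 5.9 (iv) p.332 (PDF p.106)].  abc-iut cell, block F, seat abc-iut-f-123 (owner of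
tranche 123: FACT-LIST rows **F-0545 `EnvIsoBiTheta`**, **F-0546 `FrdIsMonoThetaEnv`**).  PROOF-ONLY sequel of this seat's
`Discharge/Sec5Lem59ivToyMuThreeData.lean` (`thetaEnvData₃ : ThetaEnvData 3` with cyclotome `μ_3` over abc-iut-w5-d026's
`Lem59vToy.toyTheta₃`; `facts_toy₃`, `DY_eq_bot₃`, `frdD_eq_closure₃`, `exists_topOut_ne_one₃`) and companion of
`Discharge/Sec5Lem59ivDegenerateCriterion.lean` (the same results at abc-iut-f-115's degenerate datum, where `μ_1(B_N) = 1`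
makes every clause of the §5 ↔ §2 dictionary an identity in the trivial group).  Instance form of record fed BY NAME:
abc-iut-L2-t11's `ThetaFrobenioid.envIsoBiTheta_of` (`Discharge/Sec5BiThetaIso.lean`).

PROVED (FACT-LIST R5, named instances; FQ prefix `Literature.AnabelianGeometry.EtaleTheta.ThetaFrobenioid.Lem59vToy.`):
* the seven dictionary hypotheses of `envIsoBiTheta_of` DISCHARGED at `(toyTheta₃, thetaEnvData₃)` for every continuous `ι`
  carrying `Π^tp_Y̲, Π^tp_Ÿ̲` onto `Π^tp_Y, Π^tp_Ÿ` and `m := μ_3(⋆) ⥲ ℤ/3` (w5-d026's `muTorsionEquiv`) — here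
  `CyclotomicCharacterCompatX` and `ThetaSectionCompat` are equations in the NON-trivial group `μ_3`
  (`cyclotomicCharacterCompatX_toy₃`, `thetaSectionCompat_toy₃`); `ConstOutTransported` for every `DK ⊆ {1}`,
  `KummerOutReached` always;
* **`envIsoBiTheta_toy₃_empty`** / **`frdIsMonoThetaEnv_toy₃_empty`** (closed terms) — F-0545 / F-0546 HOLD at `toyTheta₃` with
  its §5 inputs DISCHARGED (`facts_toy₃`), `DK := ∅`, `ι := id`: kernel inhabitants of the two typed Lemma 5.9 (iv)
  predicates at a datum whose cyclotome `μ_N(B_N) = ℤ/3` and extension `1 → μ_3(B_N) → E^Π_N → Π^tp_Y̲ → 1` are NOT trivial;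
* `subset_one_of_frdIsMonoThetaEnv_toy₃` and the CRITERIA `frdIsMonoThetaEnv_toy₃_iff : … DK thetaEnvData₃ ↔ DK ⊆ {1}`,
  `envIsoBiTheta_toy₃_iff : … DK thetaEnvData₃ ι ↔ (ι(Π^tp_Y̲) = Π^tp_Y ∧ ι(Π^tp_Ÿ̲) = Π^tp_Ÿ) ∧ DK ⊆ {1}` (every `DK`, every
  continuous `ι`) — as at the degenerate datum, the typed predicates fail only through the free Kummer part `DK` or a
  mis-identification `ι`; `not_frdIsMonoThetaEnv_toy₃_univ` (`DK := Out(E^Π_N)` fails): BOTH truth values at this datum too.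
HONEST FRAMING: a toy datum over `SingleObj ℤ/3` with abelian `Π^tp_X̲`; NOT the tempered Frobenioid of a curve; nothing of
[EtTh] is asserted or refuted; no FACT-LIST row is thereby proved for the genuine data; typed ≠ proved; nothing here
bears on [IUTchIII] Cor. 3.12 and no side is taken.
-/

namespace Literature.AnabelianGeometry.EtaleTheta

namespace ThetaFrobenioid

namespace Lem59vToy

open CategoryTheory Literature.AlgebraicGeometry.Frobenioids
open ConstantMultiple.Cor512Toy (Mm TD kerFstEquiv)

/-! ### The §5 ↔ §2 dictionary of `envIsoBiTheta_of` at `(toyTheta₃, thetaEnvData₃)` -/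

section Dictionary

variable (ι : toyTheta₃.PiX ≃ₜ* thetaEnvData₃.PiX)

/-- The identification `m := (μ_3(⋆) ⥲ ℤ/3)` of w5-d026, at `B_N = ⋆`, typed against `thetaEnvData₃.mu`.
[cite: MochizukiEtTh2009, Lem 5.9 (iv) p.332 (PDF p.106)] -/
theorem nonempty_muEquiv₃ : Nonempty (toyTheta₃.muTorsion toyTheta₃.BN toyTheta₃.N ≃* thetaEnvData₃.mu) :=
  ⟨muTorsionEquiv (SingleObj.star M3)⟩

/-- `ι(Π^tp_Y̲) = Π^tp_Y` elementwise from the subgroup equation. [cite: MochizukiEtTh2009, Lem 5.9 (iv) p.332 (PDF p.106)] -/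
theorem identifiesPiY₃_of_map_eq (hY : toyTheta₃.PiY.map ι.toMulEquiv.toMonoidHom = thetaEnvData₃.PiY) :
    toyTheta₃.IdentifiesPiY thetaEnvData₃ ι.toMulEquiv := by
  intro y
  constructor
  · intro hy
    exact hY.le ⟨y, hy, rfl⟩
  · intro hy
    obtain ⟨z, hz, hzy⟩ := hY.ge hy
    have hz' : z = y := ι.injective hzy
    rw [← hz']
    exact hz

/-- `ι(Π^tp_Ÿ̲) = Π^tp_Ÿ` elementwise from the subgroup equation. [cite: MochizukiEtTh2009, Lem 5.9 (iv) p.332 (PDF p.106)] -/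
theorem identifiesPiYdd₃_of_map_eq (hYdd : toyTheta₃.PiYdd.map ι.toMulEquiv.toMonoidHom = thetaEnvData₃.PiYdd) :
    toyTheta₃.IdentifiesPiYdd thetaEnvData₃ ι.toMulEquiv := by
  intro y
  constructor
  · intro hy
    exact hYdd.le ⟨y, hy, rfl⟩
  · intro hy
    obtain ⟨z, hz, hzy⟩ := hYdd.ge hy
    have hz' : z = y := ι.injective hzy
    rw [← hz']
    exact hz

/-- **`CyclotomicCharacterCompatX` at the toy datum** — an equation in `μ_3 ≠ 1`: conjugation by `s^⊓-gp_N(ρ g) = 1` is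
the identity on `μ_3(B_N)`, matching the TRIVIAL character of `thetaEnvData₃`; for every `ι` and `m`.
[cite: MochizukiEtTh2009, Lem 5.8 p.331 (PDF p.105)] -/
theorem cyclotomicCharacterCompatX_toy₃ (m : toyTheta₃.muTorsion toyTheta₃.BN toyTheta₃.N ≃* thetaEnvData₃.mu) :
    toyTheta₃.CyclotomicCharacterCompatX thetaEnvData₃ ι.toMulEquiv m := by
  intro g u u' hu
  rw [toyTheta₃_sgpCap, MonoidHom.one_apply, one_mul, inv_one, mul_one] at hu
  rw [chi₃_apply, Subtype.ext hu]

/-- **`ThetaSectionCompat` at the toy datum** — an equation in `μ_3`: the bi-Kummer difference cocycle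
`s^⊔-gp_N · (s^⊓-gp_N)⁻¹ = 1` matches the (only) cocycle `η = 1` of the collection; for every `ι`, `m`.
[cite: MochizukiEtTh2009, Prop 5.2 (iii) p.324 (PDF p.98)] -/
theorem thetaSectionCompat_toy₃ (H : toyTheta₃.Facts) (m : toyTheta₃.muTorsion toyTheta₃.BN toyTheta₃.N ≃* thetaEnvData₃.mu)
    (hYdd : toyTheta₃.IdentifiesPiYdd thetaEnvData₃ ι.toMulEquiv) :
    toyTheta₃.ThetaSectionCompat H thetaEnvData₃ ι.toMulEquiv m hYdd 1 := by
  intro h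
  have hd : toyTheta₃.diffCocycle H h = 1 := by
    apply Subtype.ext
    change toyTheta₃.sgpCup (toyTheta₃.rhoYdd h) * (toyTheta₃.sgpCap _)⁻¹ = 1
    rw [toyTheta₃_sgpCup, toyTheta₃_sgpCap, MonoidHom.one_apply, MonoidHom.one_apply, inv_one, mul_one]
  rw [hd, map_one, Pi.one_apply, inv_one]

/-- **`ConstOutTransported` at the toy datum for every `DK ⊆ {1}`** (and every `ι`, `m`, `hY`, `hχ`): the outer action
of the constants is trivial (`conjOut_eq_one₃`).  [cite: MochizukiEtTh2009, Lem 5.8 p.331 (PDF p.105)] -/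
theorem constOutTransported_toy₃_of_subset_one (H : toyTheta₃.Facts) (h8 : toyTheta₃.ConstantsEqNormalizer)
    {DK : Set (TopOut toyTheta₃.EPiN)} (hDK : DK ⊆ {1})
    (m : toyTheta₃.muTorsion toyTheta₃.BN toyTheta₃.N ≃* thetaEnvData₃.mu)
    (hY : toyTheta₃.IdentifiesPiY thetaEnvData₃ ι.toMulEquiv)
    (hχ : toyTheta₃.CyclotomicCharacterCompat thetaEnvData₃ ι.toMulEquiv m) :
    toyTheta₃.ConstOutTransported H h8 DK thetaEnvData₃ ι m hY hχ := by
  rintro _ ⟨d, hd, rfl⟩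
  have hd1 : d = 1 := by
    rcases hd with ⟨u, rfl⟩ | hd
    · exact conjOut_eq_one₃ _
    · exact hDK hd
  rw [hd1, map_one]
  exact Subgroup.one_mem _

/-- **`KummerOutReached` at the toy datum, always**: every Kummer shift is `1` (`shift_eq_one₃`).
[cite: MochizukiEtTh2009, Lem 5.8 p.331 (PDF p.105)] -/
theorem kummerOutReached_toy₃ (H : toyTheta₃.Facts) (h1 : toyTheta₃.SectionsFactor) (h3 : toyTheta₃.OuterActionLZ)
    (hsec : toyTheta₃.SgpCapSection) (hcs : toyTheta₃.SgpCupSection) (h8 : toyTheta₃.ConstantsEqNormalizer)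
    (DK : Set (TopOut toyTheta₃.EPiN)) (m : toyTheta₃.muTorsion toyTheta₃.BN toyTheta₃.N ≃* thetaEnvData₃.mu)
    (hY : toyTheta₃.IdentifiesPiY thetaEnvData₃ ι.toMulEquiv)
    (hχ : toyTheta₃.CyclotomicCharacterCompat thetaEnvData₃ ι.toMulEquiv m) :
    toyTheta₃.KummerOutReached H h1 h3 hsec hcs h8 DK thetaEnvData₃ ι m hY hχ := by
  rintro x ⟨δ, hδ, hc, rfl⟩
  have h1' : (⟨CycEnvelope.shift hδ, hc⟩ : contMulAut thetaEnvData₃.env) = 1 := Subtype.ext (shift_eq_one₃ hδ)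
  rw [h1', map_one]
  exact Subgroup.one_mem _

end Dictionary

/-! ### F-0545 / F-0546 at the toy datum with cyclotome `μ_3` -/

/-- **F-0545 at the toy datum, positive side**: for all §5 inputs, every `DK ⊆ {1}` and every continuous `ι` carrying
`Π^tp_Y̲, Π^tp_Ÿ̲` onto `Π^tp_Y, Π^tp_Ÿ`, the typed Lemma 5.9 (iv) statement HOLDS for `thetaEnvData₃` — through
abc-iut-L2-t11's `envIsoBiTheta_of` with the dictionary above (`m := μ_3(⋆) ⥲ ℤ/3`, `η := 1`).
[cite: MochizukiEtTh2009, Lem 5.9 (iv) p.332 (PDF p.106)] -/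
theorem envIsoBiTheta_toy₃_of_subset_one (h1 : toyTheta₃.SectionsFactor) (h3 : toyTheta₃.OuterActionLZ)
    (hsec : toyTheta₃.SgpCapSection) (hcs : toyTheta₃.SgpCupSection) (h8 : toyTheta₃.ConstantsEqNormalizer)
    {DK : Set (TopOut toyTheta₃.EPiN)} (hDK : DK ⊆ {1}) (ι : toyTheta₃.PiX ≃ₜ* thetaEnvData₃.PiX)
    (hY : toyTheta₃.PiY.map ι.toMulEquiv.toMonoidHom = thetaEnvData₃.PiY)
    (hYdd : toyTheta₃.PiYdd.map ι.toMulEquiv.toMonoidHom = thetaEnvData₃.PiYdd) :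
    toyTheta₃.EnvIsoBiTheta h1 h3 hsec hcs h8 DK thetaEnvData₃ ι := by
  obtain ⟨m⟩ := nonempty_muEquiv₃
  have hη : (1 : thetaEnvData₃.PiYdd → thetaEnvData₃.mu) ∈ thetaEnvData₃.thetaCocycles := Set.mem_singleton _
  exact toyTheta₃.envIsoBiTheta_of facts_toy₃ h1 h3 hsec hcs h8 DK thetaEnvData₃ ι m (identifiesPiY₃_of_map_eq ι hY)
    (identifiesPiYdd₃_of_map_eq ι hYdd) (cyclotomicCharacterCompatX_toy₃ ι m) hη
    (thetaSectionCompat_toy₃ ι facts_toy₃ m _)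
    (constOutTransported_toy₃_of_subset_one ι facts_toy₃ h8 hDK m _ _)
    (kummerOutReached_toy₃ ι facts_toy₃ h1 h3 hsec hcs h8 DK m _ _)

/-- `ι := id` carries `Π^tp_Y̲` onto `Π^tp_Y`. [cite: MochizukiEtTh2009, Lem 5.9 (iv) p.332 (PDF p.106)] -/
theorem map_PiY_refl₃ :
    toyTheta₃.PiY.map (ContinuousMulEquiv.refl toyTheta₃.PiX).toMulEquiv.toMonoidHom = thetaEnvData₃.PiY := by
  ext x
  constructor
  · rintro ⟨y, hy, rfl⟩
    exact hy
  · intro hx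
    exact ⟨x, hx, rfl⟩

/-- `ι := id` carries `Π^tp_Ÿ̲` onto `Π^tp_Ÿ`. [cite: MochizukiEtTh2009, Lem 5.9 (iv) p.332 (PDF p.106)] -/
theorem map_PiYdd_refl₃ :
    toyTheta₃.PiYdd.map (ContinuousMulEquiv.refl toyTheta₃.PiX).toMulEquiv.toMonoidHom = thetaEnvData₃.PiYdd := by
  ext x
  constructor
  · rintro ⟨y, hy, rfl⟩
    exact hy
  · intro hx
    exact ⟨x, hx, rfl⟩

/-- **F-0545 HOLDS at the toy datum (`μ_3(B_N) = ℤ/3`) for `ι := id` and every `DK ⊆ {1}`.**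
[cite: MochizukiEtTh2009, Lem 5.9 (iv) p.332 (PDF p.106)] -/
theorem envIsoBiTheta_toy₃_refl_of_subset_one (h1 : toyTheta₃.SectionsFactor) (h3 : toyTheta₃.OuterActionLZ)
    (hsec : toyTheta₃.SgpCapSection) (hcs : toyTheta₃.SgpCupSection) (h8 : toyTheta₃.ConstantsEqNormalizer)
    {DK : Set (TopOut toyTheta₃.EPiN)} (hDK : DK ⊆ {1}) :
    toyTheta₃.EnvIsoBiTheta h1 h3 hsec hcs h8 DK thetaEnvData₃ (ContinuousMulEquiv.refl toyTheta₃.PiX) :=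
  envIsoBiTheta_toy₃_of_subset_one h1 h3 hsec hcs h8 hDK _ map_PiY_refl₃ map_PiYdd_refl₃

/-- **F-0545 MODEL-WITNESSED AT A NON-TRIVIAL CYCLOTOME (closed term)**: `EnvIsoBiTheta` at w5-d026's toy datum with its
§5 inputs DISCHARGED (`facts_toy₃`), `DK := ∅`, `T := thetaEnvData₃`, `ι := id`.
[cite: MochizukiEtTh2009, Lem 5.9 (iv) p.332 (PDF p.106)] -/
theorem envIsoBiTheta_toy₃_empty :
    toyTheta₃.EnvIsoBiTheta facts_toy₃.sectionsFactor toyTheta₃.outerActionLZ_of facts_toy₃.sgpCapSection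
      facts_toy₃.sgpCupSection facts_toy₃.constantsEqNormalizer ∅ thetaEnvData₃
      (ContinuousMulEquiv.refl toyTheta₃.PiX) :=
  envIsoBiTheta_toy₃_refl_of_subset_one _ _ _ _ _ (Set.empty_subset _)

/-- **F-0546 MODEL-WITNESSED AT A NON-TRIVIAL CYCLOTOME (closed term)**: `FrdIsMonoThetaEnv` at the toy datum with its
§5 inputs discharged, `DK := ∅`, `T := thetaEnvData₃` (via abc-iut-L2-t4's `frdIsMonoThetaEnv_of`).
[cite: MochizukiEtTh2009, Lem 5.9 (iv) p.332 (PDF p.106)] -/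
theorem frdIsMonoThetaEnv_toy₃_empty :
    toyTheta₃.FrdIsMonoThetaEnv facts_toy₃.sectionsFactor toyTheta₃.outerActionLZ_of facts_toy₃.sgpCapSection
      facts_toy₃.sgpCupSection facts_toy₃.constantsEqNormalizer ∅ thetaEnvData₃ :=
  toyTheta₃.frdIsMonoThetaEnv_of _ _ _ _ _ ∅ thetaEnvData₃ _ envIsoBiTheta_toy₃_empty

/-! ### Necessity and the criteria -/

/-- **Necessity**: for ANY §2 datum `T` over the toy's `N = 3` with trivial `D_Y` and any Kummer part `DK`, if
`frdMonoThetaEnv … DK` IS a mono-theta environment for `T`, then `DK ⊆ {1}` (`D = ⟨DK⟩` is transported injectively onto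
`D_Y = 1`).  [cite: MochizukiEtTh2009, Lem 5.9 (iv) p.332 (PDF p.106)] -/
theorem subset_one_of_frdIsMonoThetaEnv_toy₃ (h1 : toyTheta₃.SectionsFactor) (h3 : toyTheta₃.OuterActionLZ)
    (hsec : toyTheta₃.SgpCapSection) (hcs : toyTheta₃.SgpCupSection) (h8 : toyTheta₃.ConstantsEqNormalizer)
    {DK : Set (TopOut toyTheta₃.EPiN)} (T : ThetaEnvData.{0} toyTheta₃.N) (hDY : T.DY = ⊥)
    (h : toyTheta₃.FrdIsMonoThetaEnv h1 h3 hsec hcs h8 DK T) : DK ⊆ {1} := by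
  intro d hd
  obtain ⟨η, hη, ⟨i⟩⟩ := h
  have hmem : d ∈ (toyTheta₃.frdMonoThetaEnv h1 h3 hsec hcs h8 DK).D := by
    rw [frdD_eq_closure₃]
    exact Subgroup.subset_closure hd
  have h2 : TopOut.transport i.e d ∈ (T.modelMono hη).D := by
    rw [← i.map_D]
    exact Subgroup.mem_map_of_mem _ hmem
  change TopOut.transport i.e d ∈ T.DY at h2
  rw [hDY, Subgroup.mem_bot] at h2
  have hback := ThetaFrobenioid.transport_transport_symm_apply i.e.symm d
  rw [ContinuousMulEquiv.symm_symm, h2, map_one] at hback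
  exact hback.symm

/-- **CRITERION (F-0546 at the toy datum)**: for all §5 inputs and every `DK`,
`FrdIsMonoThetaEnv … DK thetaEnvData₃ ↔ DK ⊆ {1}`.  [cite: MochizukiEtTh2009, Lem 5.9 (iv) p.332 (PDF p.106)] -/
theorem frdIsMonoThetaEnv_toy₃_iff (h1 : toyTheta₃.SectionsFactor) (h3 : toyTheta₃.OuterActionLZ)
    (hsec : toyTheta₃.SgpCapSection) (hcs : toyTheta₃.SgpCupSection) (h8 : toyTheta₃.ConstantsEqNormalizer)
    (DK : Set (TopOut toyTheta₃.EPiN)) :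
    toyTheta₃.FrdIsMonoThetaEnv h1 h3 hsec hcs h8 DK thetaEnvData₃ ↔ DK ⊆ {1} :=
  ⟨subset_one_of_frdIsMonoThetaEnv_toy₃ h1 h3 hsec hcs h8 thetaEnvData₃ DY_eq_bot₃, fun hDK =>
    toyTheta₃.frdIsMonoThetaEnv_of h1 h3 hsec hcs h8 DK thetaEnvData₃ _
      (envIsoBiTheta_toy₃_refl_of_subset_one h1 h3 hsec hcs h8 hDK)⟩

/-- **CRITERION (F-0545 at the toy datum)**: for all §5 inputs, every `DK` and every continuous `ι`,
`EnvIsoBiTheta … DK thetaEnvData₃ ι ↔ (ι(Π^tp_Y̲) = Π^tp_Y ∧ ι(Π^tp_Ÿ̲) = Π^tp_Ÿ) ∧ DK ⊆ {1}`.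
[cite: MochizukiEtTh2009, Lem 5.9 (iv) p.332 (PDF p.106)] -/
theorem envIsoBiTheta_toy₃_iff (h1 : toyTheta₃.SectionsFactor) (h3 : toyTheta₃.OuterActionLZ)
    (hsec : toyTheta₃.SgpCapSection) (hcs : toyTheta₃.SgpCupSection) (h8 : toyTheta₃.ConstantsEqNormalizer)
    (DK : Set (TopOut toyTheta₃.EPiN)) (ι : toyTheta₃.PiX ≃ₜ* thetaEnvData₃.PiX) :
    toyTheta₃.EnvIsoBiTheta h1 h3 hsec hcs h8 DK thetaEnvData₃ ι ↔
      (toyTheta₃.PiY.map ι.toMulEquiv.toMonoidHom = thetaEnvData₃.PiY ∧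
        toyTheta₃.PiYdd.map ι.toMulEquiv.toMonoidHom = thetaEnvData₃.PiYdd) ∧ DK ⊆ {1} := by
  constructor
  · intro h
    exact ⟨⟨h.1, h.2.1⟩, subset_one_of_frdIsMonoThetaEnv_toy₃ h1 h3 hsec hcs h8 thetaEnvData₃ DY_eq_bot₃
      (toyTheta₃.frdIsMonoThetaEnv_of h1 h3 hsec hcs h8 DK thetaEnvData₃ ι h)⟩
  · rintro ⟨⟨hY, hYdd⟩, hDK⟩
    exact envIsoBiTheta_toy₃_of_subset_one h1 h3 hsec hcs h8 hDK ι hY hYdd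

/-- **F-0546 FAILS at the toy datum for `DK := Out(E^Π_N)`** — so at this datum too (cyclotome `μ_3`) the typed predicate
takes both truth values, located in the free Kummer part.  [cite: MochizukiEtTh2009, Lem 5.9 (iv) p.332 (PDF p.106)] -/
theorem not_frdIsMonoThetaEnv_toy₃_univ (h1 : toyTheta₃.SectionsFactor) (h3 : toyTheta₃.OuterActionLZ)
    (hsec : toyTheta₃.SgpCapSection) (hcs : toyTheta₃.SgpCupSection) (h8 : toyTheta₃.ConstantsEqNormalizer) :
    ¬ toyTheta₃.FrdIsMonoThetaEnv h1 h3 hsec hcs h8 Set.univ thetaEnvData₃ := fun h =>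
  not_univ_subset_one₃ ((frdIsMonoThetaEnv_toy₃_iff h1 h3 hsec hcs h8 _).mp h)

end Lem59vToy

end ThetaFrobenioid

end Literature.AnabelianGeometry.EtaleTheta
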